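import Summits.BirchSwinnertonDyer.BirchSwinnertonDyer.Theorems.ByReductionTypeAtTwoAdditiveReducibleKatoMemberSharpNST
import Summits.BirchSwinnertonDyer.BirchSwinnertonDyer.Theses.ByReductionTypeAtTwo
import HarnessLib

/-!
# Route `ByReductionTypeAtTwo` (K4), child C2″ `AdditivePotGoodReducibleRestAtTwo` (item stmt-BirchSwinnertonDyer-22616):
# Kato's SHARP member road at `p = 2` with Coates–Sujatha's (A)₂ on the `E[2]`-REDUCIBLE curves as ONE DISPLAYED hypothesis
# — Lim 2017 Thm. 3.5 at `2` and Ferrero–Washington no longer enter (a `--supports 22616` file; seat `bsd-2adic-k4-w2` GEN 9)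

HONEST FRAMING (cell `bsd-2adic`, D-0036/D-0054): THEOREMS ONLY (no definition, no named fact, no `sorry`); every theorem is
CONDITIONAL on the named facts it displays; the route decl C2″ is reached VERBATIM in §3 modulo PRINT {modularity (`hmod`,
`hrat`), Cassels (`hCassels`), GZK (`hGZK`)} + the SHARP member READING (`hin` = item 23905 `AddRedSharpCountReadingAtTwo` =
`Kato2004.exists_memberHullInputs_two_sharp_of_noSplitTwistNegOneNegTwo`, D-audit hMH2♯ PASS) + ONE displayed hypothesis `hA`;
closes nothing at the `∀`-level; BSD is not proved by any of this.

WHY. k4-w2 GEN 4's road to C2″ (`…AdditiveReducibleKatoMemberSharp{,NST}.lean`, p673737/p674406/p674829) and addL2x GEN 10's member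
door (`…AdditiveReducibleKatoMember.lean`) use Lim 2017 Thm. 3.5 at `2` (`hLim2`, the DOWNSTAIRS `L`-form
`Lim2017.thm35_at_two_fineSelmerDual_moduleFinite_of_classicalMuVanishes_of_le_divisionField_four`) and Ferrero–Washington (`hFW`)
at EXACTLY ONE place: statement (A) at `(W', 2)` for Kato's member `W'`, whose `W'[2]` is REDUCIBLE
(`conjA_two_of_not_irreducible hLim2 hFW W' hred'`). This file re-keys that one place as a displayed hypothesis

  `hA : ∀ V elliptic over ℚ, ¬ (V[2] irreducible) → ∀ κ cyclotomic, ∃ γ D, D.X finitely generated over ℤ₂`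

(«Coates–Sujatha's Conjecture A at `2` on the `E[2]`-reducible elliptic curves over `ℚ`», in the route's `∃ γ D` currency), so that
whatever supplies (A)₂ on reducible curves supplies C2″. The sequel `…AdditiveKatoFineConjAReducibleKernel.lean` (this seat) PROVES `hA`
outright (rational `2`-torsion point `P` ⇒ carrier `ℚ(P, √−1) = ℚ(√−1)`, whose every `ℤ₂`-extension has `μ = 0` by Iwasawa 1956 at
`h(ℚ(√−1)) = 1`; then cruxlead-19573-w2's KERNEL door `PointFieldMu.exists_fineSelmerDualData_moduleFinite_of_classicalMu_pointField_adjoin`,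
p718233) — after which `hLim2` and `hFW` are IDLE on the whole `E[2]`-reducible additive branch.

* §1 `katoMemberShaBound_two_sharp_NST_of_conjARed` — GEN 4's `katoMemberShaBound_two_sharp_NST` (member bound with BSD's own exponent
  `2t`, under (NST′) «no split multiplicative twist by `−1`/`−2`», so potentially good AND potentially multiplicative reducible curves)
  with `(hLim2, hFW)` replaced by `hA`; the proof is GEN 4's word for word (adapted copy, one line changed).
* §2 `missingUpperBoundAt_two_of_katoMemberSharp_two_NST_of_conjARed` — hU3 = `MissingUpperBoundAt W 2` for every globally minimal
  non-CM (NST′) additive `W` with `W[2]` reducible and `r_an = 0` (Miller currency + Cassels transport, GEN 4's §2); the potentially good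
  specialisation `missingUpperBoundAt_two_of_katoMemberSharp_two_of_conjARed` (`0 ≤ ord₂ j` ⟹ (NST′),
  `noSplitTwistNegOneNegTwo_of_padicValRat_j_nonneg`).
* §3 **`additivePotGoodReducibleRestAtTwo_of_sharpMember_of_conjARed`** — C2″ VERBATIM from `hmod`, `hrat`, `hin`, `hA`, `hCassels`, `hGZK`
  (through GEN 4's `additivePotGoodReducibleRestAtTwo_of_sharpMemberBound`, the sharp reading entering via §1 only); and the pot-mult
  (NST′) block forms `addPotMultNST_reducibleUpper_two_sharp_of_conjARed` / `addNST_reducibleUpper_two_sharp_of_conjARed` (habitat of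
  C4″'s reducible (NST′) upper half, k4-w3's lane — offered, not consumed here).

References: [Kato2004Asterisque] Thm. 12.4–12.6, (12.5.1) (pp. 221–222), 13.13 (p. 233), Thm. 14.5 (p. 236), §14.8, §14.14,
Prop. 14.16 (2) and its proof (pp. 238–245); [MazurRubin2004] Thm. 2.3.4; [CoatesSujatha2005] Conj. A; [Cassels1965ArithmeticVIII];
[MilneADT2006] I.7.3; [Miller2011LMS] Def. 1.1.
-/

set_option autoImplicit false
-- sibling precedent (`…AdditiveReducibleKatoMemberSharpNST.lean`): the directory name repeats the summit name
set_option linter.dupNamespace false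

noncomputable section

open scoped Classical

namespace Summit.BirchSwinnertonDyer.BirchSwinnertonDyer.Theorems.AddKatoTwo

open WeierstrassCurve Literature.NumberTheory.EllipticCurves
  Literature.NumberTheory.EllipticCurves.ModularForms
  Literature.NumberTheory.EllipticCurves.Kato2004
  Literature.NumberTheory.EllipticCurves.IwasawaAlgebra
  Literature.NumberTheory.EllipticCurves.Rank1Residual
  Literature.NumberTheory.EllipticCurves.Rank1Residual.Typed
  Literature.NumberTheory.IwasawaTheory
  Summit.BirchSwinnertonDyer.Rank1Residual Summit.BirchSwinnertonDyer.Rank1Residual.Additive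
  Summit.BirchSwinnertonDyer.Rank1Residual.X5.AddTwoL2

/-! ## §1 Kato's member bound at `p = 2` under (NST′), SHARP, with (A)₂ on reducible curves displayed -/

/-- **Kato's member bound at `p = 2` for REDUCIBLE `E[2]` under (NST′), SHARP, keyed on a displayed (A)₂** — k4-w2 GEN 4's
`katoMemberShaBound_two_sharp_NST` with the pair (Lim 2017 Thm. 3.5 at `2`, Ferrero–Washington) replaced by the ONE thing it was
used for: `hA`, Coates–Sujatha's statement (A) at `2` for every elliptic curve over `ℚ` with reducible `2`-torsion (in the `∃ γ D`
currency). Granted modularity (`hmod`), the (NST′)-sharp member reading (`hin`) and `hA`: for `W/ℚ` globally minimal, non-CM, additive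
at `2` with no split multiplicative twist by `−1`/`−2`, `W[2]` reducible, `L(W,1) ≠ 0`, `Ш(W)` finite, Kato's member `W' ∼ W` is
globally minimal with `Ш(W')` finite and `ord₂ #Ш(W')[2^∞] + v₂ Tam(W') ≤ ord₂(L(W',1)/Ω(W')) + 2·ord₂ #W'(ℚ)_tors`. Proof = GEN 4's,
word for word (`W'[2]` is reducible with `W[2]`, `not_hasIrreducibleModPGaloisRep_of_isIsogenous`, so `hA` applies at `W'`).
Conditional on `hmod`, `hin`, `hA`; nothing else assumed.
[cite: Kato2004Asterisque, Thm. 12.5 (3) and (12.5.1) (p. 222), 13.13 (p. 233), Thm. 12.6 (p. 222), Lemma 13.10 (1) (p. 230), 13.14 (p. 234), §14.14 and Lemma 14.15 (pp. 243–244), Prop. 14.16 (2) and its proof (pp. 244–245), §14.8 (p. 238)]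
[cite: MazurRubin2004, Thm. 2.3.4] [cite: CoatesSujatha2005, Conj. A (the displayed input)] -/
-- adapted from Theorems/ByReductionTypeAtTwoAdditiveReducibleKatoMemberSharpNST.lean §1 (k4-w2 GEN 4): `(hLim2, hFW)` ↦ `hA`
theorem katoMemberShaBound_two_sharp_NST_of_conjARed (hmod : exists_isNewformOf)
    (hin : Kato2004.exists_memberHullInputs_two_sharp_of_noSplitTwistNegOneNegTwo)
    (hA : ∀ (V : WeierstrassCurve ℚ) [V.IsElliptic], ¬ V.HasIrreducibleModPGaloisRep 2 →
      ∀ (κ : ZpExtension ℚ 2), κ.IsCyclotomic →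
        ∃ (γ : Field.absoluteGaloisGroup ℚ) (D : V.FineSelmerDualData κ γ),
          Module.Finite ℤ_[2] (RestrictScalars ℤ_[2] (IwasawaAlgebra 2) D.X))
    (W : WeierstrassCurve ℚ) [W.IsElliptic] [W.IsGloballyMinimal] (hcm : ¬ W.HasCM)
    (hng : ¬ W.HasGoodReductionAtPrime 2) (hnm : ¬ W.HasMultiplicativeReductionAtPrime 2)
    (hnst : ∀ d : ℚ, d = -1 ∨ d = -2 → ¬ (W.quadraticTwist d).HasSplitMultiplicativeReductionAtPrime 2)
    (hred : ¬ W.HasIrreducibleModPGaloisRep 2)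
    (hL : W.entireLFunction 1 ≠ 0) (hfin : Finite W.sha) :
    ∃ (W' : WeierstrassCurve ℚ) (_ : W'.IsElliptic) (_ : W'.IsGloballyMinimal),
      IsIsogenous W W' ∧ Finite W'.sha ∧
      ∃ q : ℚ, W'.entireLFunction 1 / (W'.realPeriodRat : ℂ) = (q : ℂ) ∧
        (padicValNat 2 (Nat.card (AddCommGroup.primaryComponent W'.sha 2)) : ℤ) +
            padicValNat 2 W'.tamagawaProduct ≤
          padicValRat 2 q + 2 * (padicValNat 2 W'.torsionOrder : ℤ) := by
  -- Kato's member `W'` and the fact's data at it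
  obtain ⟨W', hE', hM', hiso, hrest⟩ := hin W hcm hng hnm hnst hred hL hfin
  haveI := hE'
  haveI := hM'
  haveI : ContinuousSMul ℤ_[2] (W'.tateModule 2) := TateModule.continuousSMul_padicInt
  haveI : Module.Free ℤ_[2] (W'.tateModule 2) := W'.module_free_tateModule_holds 2
  haveI : Module.Finite ℤ_[2] (W'.tateModule 2) := W'.module_finite_tateModule_holds 2
  -- statement (A) at `(W', 2)`: `W'[2]` is reducible with `W[2]`; the DISPLAYED hypothesis `hA`
  have hred' : ¬ W'.HasIrreducibleModPGaloisRep 2 := not_hasIrreducibleModPGaloisRep_of_isIsogenous hiso hred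
  have hA' := hA W' hred'
  -- a newform of `W` (modularity) and a family of complex embeddings of the cyclotomic fields
  haveI : NeZero (W.conductorNorm ℤ) := ⟨(W.conductorNorm_pos_holds).ne'⟩
  obtain ⟨f, hf⟩ := hmod W
  obtain ⟨κ', Λ', c, d, a, A, z, x, -, -, -, -, hbody, hpack⟩ :=
    hrest hA' f hf (fun m => Classical.arbitrary _)
  -- the cyclotomic `ℤ₂`-tower with a topological generator (PROVED), the pinned `𝐇¹_Γ(T₂W')`, the lift `𝐲`
  obtain ⟨κ, hκ, γ, hγ, -⟩ := exists_isCyclotomic_isTopGenerator_isCyclotomicVariable_holds 2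
  obtain ⟨I⟩ := nonempty_iwasawaH1Data_holds W' 2 κ γ hκ hγ
  obtain ⟨y, hy⟩ :=
    (IwasawaH1Data.existsUnique_lift_of_zetaBody_two W' hκ I f (fun m => Classical.arbitrary _)
      κ' Λ' c d a A z x hbody).exists
  -- the package at `(I, 𝐲)` together with the SHARP count
  obtain ⟨K, q, hq, hcount⟩ := hpack κ γ hκ hγ I y hy
  have hfin' : Finite W'.sha := (IsIsogenous.shaFinite_iff_shaFinite hiso).mp hfin
  haveI := K.finite_H
  haveI := K.torsionFree_H
  haveI := K.finite_F
  haveI := K.torsionFree_F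
  haveI := K.finite_H2
  -- the divisibility for the hull at EVERY height-one prime: off `(2)` Thm. 12.5 (3), at `(2)` `μ = 0`
  have hdiv : ∀ 𝔮 : PrimeSpectrum (IwasawaAlgebra 2), 𝔮.asIdeal.height = 1 →
      Module.lengthAt (IwasawaAlgebra 2) K.H2 𝔮 ≤
        Module.lengthAt (IwasawaAlgebra 2) (K.F ⧸ (IwasawaAlgebra 2) ∙ K.z) 𝔮 := by
    intro 𝔮 h𝔮
    by_cases hq' : 𝔮.asIdeal = augIdealP 2
    · have hμ : (Module.lengthAt (IwasawaAlgebra 2) K.H2 𝔮).toNat = 0 := by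
        rw [← muInvariant_eq_toNat_lengthAt 2 K.H2 𝔮 hq']; exact K.mu_H2
      have hfinl : Module.lengthAt (IwasawaAlgebra 2) K.H2 𝔮 ≠ ⊤ :=
        IwasawaAlgebra.lengthAt_ne_top_of_isTorsion K.H2 K.isTorsion_H2 𝔮 (le_of_eq h𝔮)
      have h0' : Module.lengthAt (IwasawaAlgebra 2) K.H2 𝔮 = 0 := by
        rw [← ENat.coe_toNat hfinl, hμ]; rfl
      rw [h0']
      exact bot_le
    · exact K.divisibility_offP 𝔮 h𝔮 hq'
  -- the hull descent with the multiplier (PROVED module theory over `ℤ₂⟦X⟧`)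
  have hhull := valuation_add_padicValNat_coinvariants_le_of_hull_smul K.j K.j_injective
    K.finite_coker K.z K.z_ne_zero K.isTorsion_quotient K.isTorsion_H2 hdiv y K.lam
    K.lam_constantCoeff_ne_zero K.j_y K.ι K.π K.ι_injective K.π_surjective K.exact_ι_π
    K.finite_coinvariants_H2 K.index_ne_zero
  -- the sharp count; the multiplier and the `𝐇²` terms cancel
  refine ⟨W', hE', hM', hiso, hfin', q, hq, ?_⟩
  have hhull' : ((PowerSeries.constantCoeff K.lam).valuation : ℤ) +
      (padicValNat 2 (Nat.card (coinvariants 2 K.H2)) : ℤ) ≤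
      (padicValNat 2 (Nat.card (K.A ⧸ (IwasawaAlgebra 2) ∙ K.ι (Submodule.Quotient.mk y))) : ℤ) := by
    exact_mod_cast hhull
  linarith


/-! ## §2 The upper half on every (NST′) reducible additive curve, keyed on `hA` -/

/-- **hU3 = `MissingUpperBoundAt W 2` for EVERY globally minimal non-CM `W` ADDITIVE at `2` with (NST′), `W[2]` reducible and
`r_an(W) = 0`**, granted `hmod`/`hrat` (modularity), the (NST′)-sharp member reading (`hin`), `hA` ((A)₂ on reducible curves),
Cassels (`hCassels`) and GZK (`hGZK`) BY NAME — NO torsion side condition, NO parity hypothesis, NO Lim@2, NO Ferrero–Washington.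
GEN 4's `missingUpperBoundAt_two_of_katoMemberSharp_two_NST` with §1 for its §1: `L(W,1) ≠ 0` (modularity), `Ш(W)` finite (GZK),
the member bound (§1), Miller currency at the member (`missingUpperBoundAt_of_sharpKatoCurrency`), Cassels transport
(`TwistComparison.missingUpperBoundAt_of_isIsogenous`). Conditional on the named facts and `hA`.
[cite: Kato2004Asterisque, Prop. 14.16 (2) and its proof (pp. 244–245), (12.5.1) (p. 222), 13.13 (p. 233)]
[cite: Cassels1965ArithmeticVIII] [cite: MilneADT2006, Thm. I.7.3] [cite: Miller2011LMS, Def. 1.1] -/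
theorem missingUpperBoundAt_two_of_katoMemberSharp_two_NST_of_conjARed (hmod : exists_isNewformOf)
    (hin : Kato2004.exists_memberHullInputs_two_sharp_of_noSplitTwistNegOneNegTwo)
    (hA : ∀ (V : WeierstrassCurve ℚ) [V.IsElliptic], ¬ V.HasIrreducibleModPGaloisRep 2 →
      ∀ (κ : ZpExtension ℚ 2), κ.IsCyclotomic →
        ∃ (γ : Field.absoluteGaloisGroup ℚ) (D : V.FineSelmerDualData κ γ),
          Module.Finite ℤ_[2] (RestrictScalars ℤ_[2] (IwasawaAlgebra 2) D.X))
    (hCassels : bsdRHS_eq_of_isIsogenous)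
    (hGZK : rank_eq_analyticRank_of_analyticRank_le_one) (hrat : hasEntireLFunction_rat)
    (W : WeierstrassCurve ℚ) [W.IsElliptic] [W.IsGloballyMinimal] (hcm : ¬ W.HasCM)
    (hng : ¬ W.HasGoodReductionAtPrime 2) (hnm : ¬ W.HasMultiplicativeReductionAtPrime 2)
    (hnst : ∀ d : ℚ, d = -1 ∨ d = -2 → ¬ (W.quadraticTwist d).HasSplitMultiplicativeReductionAtPrime 2)
    (hred : ¬ W.HasIrreducibleModPGaloisRep 2) (hr : W.analyticRank = 0) :
    MissingUpperBoundAt W 2 := by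
  -- `L(W,1) ≠ 0` (modularity) and `Ш(W)` finite (GZK)
  have hL : W.entireLFunction 1 ≠ 0 := (W.analyticRank_eq_zero_iff_holds (hrat W)).mp hr
  have hr1 : W.analyticRank ≤ 1 := by rw [hr]; exact zero_le_one
  have hfinW : W.ShaFinite := (hGZK W hr1).2
  -- Kato's member `W'` with the sharp count
  obtain ⟨W', hE', hM', hiso, hfin', q, hq, hle⟩ :=
    katoMemberShaBound_two_sharp_NST_of_conjARed hmod hin hA W hcm hng hnm hnst hred hL hfinW
  haveI := hE'
  haveI := hM'
  have hr' : W'.analyticRank = 0 := by rw [← analyticRank_eq_of_isIsogenous' hiso, hr]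
  have hr1' : W'.analyticRank ≤ 1 := by rw [hr']; exact zero_le_one
  -- the upper half at the member, then Cassels transport `W' ∼ W`
  have hW' : MissingUpperBoundAt W' 2 :=
    missingUpperBoundAt_of_sharpKatoCurrency hGZK hrat W' 2 hr' hfin' hq hle
  exact TwistComparison.missingUpperBoundAt_of_isIsogenous _ W 2 hCassels hGZK hrat hiso.symm_of_charZero hr1' hW'

/-- **hU3 on the POTENTIALLY GOOD reducible additive rank-`0` non-CM curves, keyed on `hA`** — `0 ≤ ord₂ j` gives (NST′)
(`noSplitTwistNegOneNegTwo_of_padicValRat_j_nonneg`), then the previous theorem. No torsion/parity side condition; no Lim@2, no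
Ferrero–Washington. Conditional on `hmod`, `hrat`, `hin`, `hA`, `hCassels`, `hGZK`.
[cite: Kato2004Asterisque, Prop. 14.16 (2) (p. 244), Thm. 12.5 (3) (p. 222)] [cite: Cassels1965ArithmeticVIII] -/
theorem missingUpperBoundAt_two_of_katoMemberSharp_two_of_conjARed (hmod : exists_isNewformOf)
    (hin : Kato2004.exists_memberHullInputs_two_sharp_of_noSplitTwistNegOneNegTwo)
    (hA : ∀ (V : WeierstrassCurve ℚ) [V.IsElliptic], ¬ V.HasIrreducibleModPGaloisRep 2 →
      ∀ (κ : ZpExtension ℚ 2), κ.IsCyclotomic →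
        ∃ (γ : Field.absoluteGaloisGroup ℚ) (D : V.FineSelmerDualData κ γ),
          Module.Finite ℤ_[2] (RestrictScalars ℤ_[2] (IwasawaAlgebra 2) D.X))
    (hCassels : bsdRHS_eq_of_isIsogenous)
    (hGZK : rank_eq_analyticRank_of_analyticRank_le_one) (hrat : hasEntireLFunction_rat)
    (W : WeierstrassCurve ℚ) [W.IsElliptic] [W.IsGloballyMinimal] (hcm : ¬ W.HasCM)
    (hng : ¬ W.HasGoodReductionAtPrime 2) (hnm : ¬ W.HasMultiplicativeReductionAtPrime 2)
    (hj : 0 ≤ padicValRat 2 W.j) (hred : ¬ W.HasIrreducibleModPGaloisRep 2) (hr : W.analyticRank = 0) :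
    MissingUpperBoundAt W 2 :=
  missingUpperBoundAt_two_of_katoMemberSharp_two_NST_of_conjARed hmod hin hA hCassels hGZK hrat W hcm hng hnm
    (noSplitTwistNegOneNegTwo_of_padicValRat_j_nonneg W hj) hred hr

/-! ## §3 C2″ VERBATIM, and the (NST′) block forms, keyed on `hA` -/

/-- **C2″ `AdditivePotGoodReducibleRestAtTwo` (item 22616) — the route decl VERBATIM — from modularity (`hmod`, `hrat`), the SHARP
member reading (`hin` = item 23905 `AddRedSharpCountReadingAtTwo`), (A)₂ on the `E[2]`-reducible curves (`hA`), Cassels (`hCassels`)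
and GZK (`hGZK`)**: GEN 4's `additivePotGoodReducibleRestAtTwo_of_sharpMemberBound` with §1 (through
`exists_memberHullInputs_two_sharp_of_noSplitTwistSharp`-style specialisation (NST′) ⟸ `0 ≤ ord₂ j`) supplying the member bound.
Compared with GEN 4's `additivePotGoodReducibleRestAtTwo_of_sharpMember'` the binders `hLim2` (Lim 2017 Thm. 3.5 at `2`) and `hFW`
(Ferrero–Washington) are GONE, replaced by `hA`. The item does NOT close (named-fact hypotheses; `hA` is discharged in the sequel
file, the others are PRINT). The excluded conjunct of C2″ (the member sub-block side conditions) is not used: the sharp count needs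
no side condition. [cite: Kato2004Asterisque, Prop. 14.16 (2) and its proof (pp. 244–245)] [cite: Cassels1965ArithmeticVIII]
[cite: MilneADT2006, Thm. I.7.3] [cite: Miller2011LMS, Def. 1.1] -/
theorem additivePotGoodReducibleRestAtTwo_of_sharpMember_of_conjARed (hmod : exists_isNewformOf)
    (hrat : hasEntireLFunction_rat) (hin : Kato2004.exists_memberHullInputs_two_sharp_of_noSplitTwistNegOneNegTwo)
    (hA : ∀ (V : WeierstrassCurve ℚ) [V.IsElliptic], ¬ V.HasIrreducibleModPGaloisRep 2 →
      ∀ (κ : ZpExtension ℚ 2), κ.IsCyclotomic →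
        ∃ (γ : Field.absoluteGaloisGroup ℚ) (D : V.FineSelmerDualData κ γ),
          Module.Finite ℤ_[2] (RestrictScalars ℤ_[2] (IwasawaAlgebra 2) D.X))
    (hCassels : bsdRHS_eq_of_isIsogenous) (hGZK : rank_eq_analyticRank_of_analyticRank_le_one) :
    Summit.BirchSwinnertonDyer.BirchSwinnertonDyer.Theses.ByReductionTypeAtTwo.AdditivePotGoodReducibleRestAtTwo :=
  additivePotGoodReducibleRestAtTwo_of_sharpMemberBound
    (fun W _ _ hcm hng hnm hj hred hL hfin => katoMemberShaBound_two_sharp_NST_of_conjARed hmod hin hA W hcm hng hnm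
      (noSplitTwistNegOneNegTwo_of_padicValRat_j_nonneg W hj) hred hL hfin)
    hCassels hGZK hrat

/-- **C2″ from the route's own support items, minus Lim@2 and Ferrero–Washington**: the glue 23906 `AdditivePotGoodReducibleRestAtTwoOfInputs`
reads `AdditivePrintedInputsAtTwo → AddRedSharpCountReadingAtTwo → C2″` and its proof destructures ELEVEN print heads, using six
(`hGZK, hrat, hLim2, hFW, hmodN, hCassels`). Here: `AddRedSharpCountReadingAtTwo` + the FOUR heads GZK, entire `L`-function, newform,
Cassels + `hA` ⟹ C2″. Bookkeeping corollary of the previous theorem (`AddRedSharpCountReadingAtTwo` unfolds to `hin` by `Iff.rfl`).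
[cite: Kato2004Asterisque, Prop. 14.16 (2) (p. 244)] [cite: Cassels1965ArithmeticVIII] -/
theorem additivePotGoodReducibleRestAtTwo_of_reading_of_conjARed
    (hinS : Summit.BirchSwinnertonDyer.BirchSwinnertonDyer.Theses.ByReductionTypeAtTwo.AddRedSharpCountReadingAtTwo)
    (hGZK : rank_eq_analyticRank_of_analyticRank_le_one) (hrat : hasEntireLFunction_rat) (hmod : exists_isNewformOf)
    (hCassels : bsdRHS_eq_of_isIsogenous)
    (hA : ∀ (V : WeierstrassCurve ℚ) [V.IsElliptic], ¬ V.HasIrreducibleModPGaloisRep 2 →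
      ∀ (κ : ZpExtension ℚ 2), κ.IsCyclotomic →
        ∃ (γ : Field.absoluteGaloisGroup ℚ) (D : V.FineSelmerDualData κ γ),
          Module.Finite ℤ_[2] (RestrictScalars ℤ_[2] (IwasawaAlgebra 2) D.X)) :
    Summit.BirchSwinnertonDyer.BirchSwinnertonDyer.Theses.ByReductionTypeAtTwo.AdditivePotGoodReducibleRestAtTwo :=
  additivePotGoodReducibleRestAtTwo_of_sharpMember_of_conjARed hmod hrat hinS hA hCassels hGZK

/-- **hU3 on the `E[2]`-REDUCIBLE potentially MULTIPLICATIVE curves satisfying (NST′), keyed on `hA`** — GEN 4's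
`addPotMultNST_reducibleUpper_two_sharp` (`¬CM → r_an = 0 → Addv W 2 → ord₂ j < 0 → (NST′) → ¬ irreducible → MissingUpperBoundAt W 2`,
the habitat of C4″'s reducible (NST′) upper half) with `(hLim2, hFW)` ↦ `hA`. Conditional; nothing asserted; offered to the C4″ lane.
[cite: Kato2004Asterisque, Prop. 14.16 (2) (p. 244), (12.5.1) (p. 222), 13.13 (p. 233)] [cite: Cassels1965ArithmeticVIII] -/
theorem addPotMultNST_reducibleUpper_two_sharp_of_conjARed (hmod : exists_isNewformOf) (hrat : hasEntireLFunction_rat)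
    (hin : Kato2004.exists_memberHullInputs_two_sharp_of_noSplitTwistNegOneNegTwo)
    (hA : ∀ (V : WeierstrassCurve ℚ) [V.IsElliptic], ¬ V.HasIrreducibleModPGaloisRep 2 →
      ∀ (κ : ZpExtension ℚ 2), κ.IsCyclotomic →
        ∃ (γ : Field.absoluteGaloisGroup ℚ) (D : V.FineSelmerDualData κ γ),
          Module.Finite ℤ_[2] (RestrictScalars ℤ_[2] (IwasawaAlgebra 2) D.X))
    (hCassels : bsdRHS_eq_of_isIsogenous) (hGZK : rank_eq_analyticRank_of_analyticRank_le_one) :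
    ∀ (W : WeierstrassCurve ℚ) [W.IsElliptic] [W.IsGloballyMinimal], ¬ W.HasCM → W.analyticRank = 0 →
      Addv W 2 → padicValRat 2 W.j < 0 →
      (∀ d : ℚ, d = -1 ∨ d = -2 → ¬ (W.quadraticTwist d).HasSplitMultiplicativeReductionAtPrime 2) →
      ¬ W.HasIrreducibleModPGaloisRep 2 → MissingUpperBoundAt W 2 := by
  intro W _ _ hcm hr hadd _ hnst hred
  exact missingUpperBoundAt_two_of_katoMemberSharp_two_NST_of_conjARed hmod hin hA hCassels hGZK hrat W hcm hadd.1 hadd.2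
    hnst hred hr

/-- **The whole (NST′) ADDITIVE reducible block at once, keyed on `hA`** (potentially good ∪ potentially multiplicative without a
split twist by `−1`/`−2`): `¬CM → r_an = 0 → Addv W 2 → (NST′) → ¬ irreducible → MissingUpperBoundAt W 2`. GEN 4's
`addNST_reducibleUpper_two_sharp` with `(hLim2, hFW)` ↦ `hA`. Conditional; nothing asserted.
[cite: Kato2004Asterisque, Prop. 14.16 (2) (p. 244), (12.5.1) (p. 222)] [cite: Cassels1965ArithmeticVIII] -/
theorem addNST_reducibleUpper_two_sharp_of_conjARed (hmod : exists_isNewformOf) (hrat : hasEntireLFunction_rat)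
    (hin : Kato2004.exists_memberHullInputs_two_sharp_of_noSplitTwistNegOneNegTwo)
    (hA : ∀ (V : WeierstrassCurve ℚ) [V.IsElliptic], ¬ V.HasIrreducibleModPGaloisRep 2 →
      ∀ (κ : ZpExtension ℚ 2), κ.IsCyclotomic →
        ∃ (γ : Field.absoluteGaloisGroup ℚ) (D : V.FineSelmerDualData κ γ),
          Module.Finite ℤ_[2] (RestrictScalars ℤ_[2] (IwasawaAlgebra 2) D.X))
    (hCassels : bsdRHS_eq_of_isIsogenous) (hGZK : rank_eq_analyticRank_of_analyticRank_le_one) :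
    ∀ (W : WeierstrassCurve ℚ) [W.IsElliptic] [W.IsGloballyMinimal], ¬ W.HasCM → W.analyticRank = 0 →
      Addv W 2 → (∀ d : ℚ, d = -1 ∨ d = -2 → ¬ (W.quadraticTwist d).HasSplitMultiplicativeReductionAtPrime 2) →
      ¬ W.HasIrreducibleModPGaloisRep 2 → MissingUpperBoundAt W 2 := by
  intro W _ _ hcm hr hadd hnst hred
  exact missingUpperBoundAt_two_of_katoMemberSharp_two_NST_of_conjARed hmod hin hA hCassels hGZK hrat W hcm hadd.1 hadd.2
    hnst hred hr

end Summit.BirchSwinnertonDyer.BirchSwinnertonDyer.Theorems.AddKatoTwo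

end
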